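import Summits.KontsevichZagierPeriods.KontsevichZagierPeriods.Theses.HyperbolicBloch
import Summits.KontsevichZagierPeriods.KontsevichZagierPeriods.Theorems.FiveTermTransfer.Negative.Reduction
import Literature.NumberTheory.Transcendental.KZIdealTetrahedron
import Literature.NumberTheory.Transcendental.KZLogCalculusProofs
import Summits.KontsevichZagierPeriods.KontsevichZagierPeriods.Theorems.HyperbolicBlochFiveTermTransferStubInversionRelation
import Summits.KontsevichZagierPeriods.KontsevichZagierPeriods.Theorems.HyperbolicBlochFiveTermTransferStubValuationKernel
import Summits.KontsevichZagierPeriods.KontsevichZagierPeriods.Theorems.HyperbolicBlochFiveTermTransferStubPrismClass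
import Summits.KontsevichZagierPeriods.KontsevichZagierPeriods.Theorems.HyperbolicBlochFiveTermTransferStubInversionMove
import Summits.KontsevichZagierPeriods.KontsevichZagierPeriods.Theorems.HyperbolicBlochFiveTermTransferStubCircuitCore
import Summits.KontsevichZagierPeriods.KontsevichZagierPeriods.Theorems.HyperbolicBlochFiveTermTransferStubDetDictionary
import Summits.KontsevichZagierPeriods.KontsevichZagierPeriods.Theorems.HyperbolicBlochFiveTermTransferStubFiveTermIndicator

/-!
# `FiveTermTransfer` (stmt-KontsevichZagierPeriods-3469) — line `valuation-kernel-sweep`, closing composition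

The five-term relation of the Bloch–Wigner dilogarithm, in Neumann's form
`B x − B y + B (y/x) − B ((1−x⁻¹)/(1−y⁻¹)) + B ((1−x)/(1−y))`, is a relation of the Kontsevich–Zagier
calculus among the standard ideal-tetrahedron representations `[T(z), t⁻³]`.

Composition (`FiveTermTransfer_of`, from the seven stub files listed in the imports):

* `stub_valuationKernel` — a `ℤ`-combination of same-dimension representations with a common
  integrand whose signed indicator vanishes a.e. is a relation (Boolean atoms + rule (1));
* `stub_prismClass` — the affine similarity `z ↦ a z + b` (and its mirror) of `ℍ³` is ONE
  change-of-variables move carrying `±[T(w)]` to the prism over the triangle `(b, a+b, aw+b)`;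
* `stub_inversionRelation` — `B w + B w⁻¹ ∈ relations` (inversion in the unit sphere, Disproof §5);
* `stub_inversionMove` — the unit inversion carries the prism over `(1, 1/x̄, 1/ȳ)` onto the finite
  ideal tetrahedron `(0, 1, x, y)` (one move);
* `stub_circuitCore` — the circuit lemma for five vectors of `ℝ⁴` in determinant (Cramer) form;
* `stub_detDictionary` — the route's forms `L`, `S` ARE the `4 × 4` determinants of the paraboloid
  lift `p ↦ (|p|², p₀, p₁, 1)`, so each of the five solids is "all four Cramer coordinates positive";
* `stub_fiveTermIndicator` (from the last two + null sphere-polynomial walls) — the signed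
  indicator identity `Σ εᵢ 𝟙_{solidᵢ} = 0` a.e. on the configuration `{∞, 0, 1, x, y}`.

Disproof used (Cruxes/FiveTermTransfer/Disproof.lean, gen 2): every load-bearing hypothesis
(`x ≠ 0`, `y ≠ 0`, `hρ`, `hB`, algebraicity) is consumed; rule (1) (kernel lemma) AND rule (2)
(normalising moves) are both used, as the refuted strengthenings demand; the sign dictionary is the
tree's `Negative/SignDictionary.lean`.
-/

noncomputable section

open MeasureTheory Set Complex
open scoped ComplexConjugate

namespace Summit.KontsevichZagierPeriods.HyperbolicBloch.FiveTerm

open Literature.NumberTheory.Transcendental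
open Literature.NumberTheory.Transcendental.KZ
open Summit.KontsevichZagierPeriods.KontsevichZagierPeriods.Theses.HyperbolicBloch (FiveTermTransfer)
open Summit.KontsevichZagierPeriods.HyperbolicBloch.FiveTermTransferNegative

/-! ## The seven stubs

All landed under `Theorems/HyperbolicBlochFiveTermTransferStub<Name>.lean` (imports above):
`stub_valuationKernel` (p72587), `stub_prismClass` (p72755), `stub_inversionRelation` (p71879),
`stub_inversionMove` (p72758), `stub_circuitCore` (p72651), `stub_detDictionary` (p72638),
`stub_fiveTermIndicator` (p73156). -/

/-! ## Composition: the stubs imply the crux -/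

/-- `sg (conj z⁻¹) = sg z` for the sign-of-imaginary-part function. [folklore] -/
theorem sg_conj_inv (sg : ℂ → ℤ) (hsg : ∀ w, sg w = if 0 < w.im then 1 else if w.im < 0 then -1 else 0)
    (z : ℂ) : sg ((starRingEnd ℂ) z⁻¹) = sg z := by
  rcases eq_or_ne z 0 with rfl | hz
  · simp
  have hN : 0 < Complex.normSq z := Complex.normSq_pos.mpr hz
  have him : ((starRingEnd ℂ) z⁻¹).im = z.im / Complex.normSq z := by
    simp [Complex.inv_im]
  rw [hsg, hsg z, him]
  rcases lt_trichotomy z.im 0 with h | h | h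
  · have h1 : z.im / Complex.normSq z < 0 := div_neg_of_neg_of_pos h hN
    simp [h, h1, not_lt.mpr h.le, not_lt.mpr h1.le]
  · simp [h]
  · have h1 : 0 < z.im / Complex.normSq z := div_pos h hN
    simp [h, h1]

/-- **Main composition**, for opaque forms `L, S, P, sg` pinned by their defining equations and a
standard family `ρ`: the five-term element of `signedClass ρ` is a relation. [folklore] -/
theorem fiveTerm_mem_relations
    (L : ℂ → ℂ → (Fin 3 → ℝ) → ℝ)
    (hL : ∀ u v p, L u v p = (v.re - u.re) * (p 1 - u.im) - (v.im - u.im) * (p 0 - u.re))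
    (S : ℂ → ℂ → ℂ → (Fin 3 → ℝ) → ℝ)
    (hS : ∀ u v w p, S u v w p = (p 0 ^ 2 + p 1 ^ 2 + p 2 ^ 2) * (u.re * (v.im - w.im) - u.im * (v.re - w.re) + (v.re * w.im - v.im * w.re)) - p 0 * (Complex.normSq u * (v.im - w.im) - u.im * (Complex.normSq v - Complex.normSq w) + (Complex.normSq v * w.im - v.im * Complex.normSq w)) + p 1 * (Complex.normSq u * (v.re - w.re) - u.re * (Complex.normSq v - Complex.normSq w) + (Complex.normSq v * w.re - v.re * Complex.normSq w)) - (Complex.normSq u * (v.re * w.im - v.im * w.re) - u.re * (Complex.normSq v * w.im - v.im * Complex.normSq w) + u.im * (Complex.normSq v * w.re - v.re * Complex.normSq w)))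
    (P : ℂ → ℂ → ℂ → Set (Fin 3 → ℝ))
    (hP : ∀ u v w, P u v w = {p | 0 < p 2 ∧ 0 < L u v ![w.re, w.im, 0] * L u v p ∧ 0 < L u v ![w.re, w.im, 0] * L v w p ∧ 0 < L u v ![w.re, w.im, 0] * L w u p ∧ 0 < L u v ![w.re, w.im, 0] * S u v w p})
    (sg : ℂ → ℤ) (hsg : ∀ w, sg w = if 0 < w.im then 1 else if w.im < 0 then -1 else 0)
    (ρ : ℂ → KZ.IntegralRep 3) (hρ : IsStandardOn ρ) (x y : ℂ) (hx : IsAlgebraic ℚ x)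
    (hy : IsAlgebraic ℚ y) (hx0 : x ≠ 0) (hx1 : x ≠ 1) (hy0 : y ≠ 0) (hy1 : y ≠ 1) (hxy : x ≠ y) :
    fiveTerm (signedClass ρ) x y ∈ KZ.relations := by
  have hB : ∀ z, signedClass ρ z = if 0 < z.im then KZ.of (ρ z) else if z.im < 0 then
      -KZ.of (ρ ((starRingEnd ℂ) z)) else 0 := fun _ => rfl
  have hρ' : ∀ z, IsAlgebraic ℚ z → 0 < z.im → (ρ z).domain = idealTetrahedron z ∧
      Set.EqOn (ρ z).integrand (fun p => 1 / p 2 ^ 3) (idealTetrahedron z) := hρ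
  -- algebraic numbers in play
  have halg1 : IsAlgebraic ℚ (1 : ℂ) := isAlgebraic_one
  have halg0 : IsAlgebraic ℚ (0 : ℂ) := isAlgebraic_zero
  have h3 : IsAlgebraic ℚ (y / x) := by rw [div_eq_mul_inv]; exact hy.mul hx.inv
  have h4 : IsAlgebraic ℚ ((1 - x⁻¹) / (1 - y⁻¹)) := by
    rw [div_eq_mul_inv]; exact (isAlgebraic_one.sub hx.inv).mul (isAlgebraic_one.sub hy.inv).inv
  have h5 : IsAlgebraic ℚ ((1 - x) / (1 - y)) := by
    rw [div_eq_mul_inv]; exact (isAlgebraic_one.sub hx).mul (isAlgebraic_one.sub hy).inv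
  have hconj : ∀ {z : ℂ}, IsAlgebraic ℚ z → IsAlgebraic ℚ ((starRingEnd ℂ) z) := fun hz => by
    simpa using hz.algHom (starRingEnd ℂ).toRatAlgHom
  have hw₄alg : IsAlgebraic ℚ ((starRingEnd ℂ) ((1 - x⁻¹) / (1 - y⁻¹))⁻¹) := hconj h4.inv
  have ha₄ : IsAlgebraic ℚ (((starRingEnd ℂ) x)⁻¹ - 1) := (hconj hx).inv.sub isAlgebraic_one
  have hcx1 : (starRingEnd ℂ) x ≠ 1 := by
    intro h; apply hx1; simpa using congrArg (starRingEnd ℂ) h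
  have hcy1 : (starRingEnd ℂ) y ≠ 1 := by
    intro h; apply hy1; simpa using congrArg (starRingEnd ℂ) h
  have ha₄0 : ((starRingEnd ℂ) x)⁻¹ - 1 ≠ 0 := by
    rw [sub_ne_zero, ne_eq, inv_eq_one]
    exact hcx1
  have hy1' : (1 : ℂ) - y ≠ 0 := sub_ne_zero.mpr (Ne.symm hy1)
  have hu₃ : ((starRingEnd ℂ) y)⁻¹ =
      (((starRingEnd ℂ) x)⁻¹ - 1) * (starRingEnd ℂ) ((1 - x⁻¹) / (1 - y⁻¹))⁻¹ + 1 := by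
    have hx' : (starRingEnd ℂ) x ≠ 0 := (map_ne_zero _).mpr hx0
    have hy' : (starRingEnd ℂ) y ≠ 0 := (map_ne_zero _).mpr hy0
    have hx1' : (starRingEnd ℂ) x - 1 ≠ 0 := sub_ne_zero.mpr hcx1
    have hx1'' : 1 - (starRingEnd ℂ) x ≠ 0 := sub_ne_zero.mpr (Ne.symm hcx1)
    have hy1'' : (starRingEnd ℂ) y - 1 ≠ 0 := sub_ne_zero.mpr hcy1
    have hy1''' : 1 - (starRingEnd ℂ) y ≠ 0 := sub_ne_zero.mpr (Ne.symm hcy1)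
    simp only [map_inv₀, map_div₀, map_sub, map_one]
    field_simp
    ring
  -- the five representations
  obtain ⟨R4, hR4d, hR4i, hR4⟩ := stub_prismClass L hL S hS P hP ρ hρ' (signedClass ρ) hB sg hsg
    1 0 x 1 x halg1 halg0 hx one_ne_zero (by ring) (by ring)
  obtain ⟨R3, hR3d, hR3i, hR3⟩ := stub_prismClass L hL S hS P hP ρ hρ' (signedClass ρ) hB sg hsg
    1 0 y 1 y halg1 halg0 hy one_ne_zero (by ring) (by ring)
  obtain ⟨R2, hR2d, hR2i, hR2⟩ := stub_prismClass L hL S hS P hP ρ hρ' (signedClass ρ) hB sg hsg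
    x 0 (y / x) x y hx halg0 h3 hx0 (by ring) (by rw [add_zero, mul_div_cancel₀ _ hx0])
  obtain ⟨R1, hR1d, hR1i, hR1⟩ := stub_prismClass L hL S hS P hP ρ hρ' (signedClass ρ) hB sg hsg
    (y - 1) 1 ((1 - x) / (1 - y)) y x (hy.sub isAlgebraic_one) halg1 h5 (sub_ne_zero.mpr hy1)
    (by ring) (by field_simp; ring)
  obtain ⟨RP, hRPd, hRPi, hRP⟩ := stub_prismClass L hL S hS P hP ρ hρ' (signedClass ρ) hB sg hsg
    (((starRingEnd ℂ) x)⁻¹ - 1) 1 ((starRingEnd ℂ) ((1 - x⁻¹) / (1 - y⁻¹))⁻¹)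
    ((starRingEnd ℂ) x)⁻¹ ((starRingEnd ℂ) y)⁻¹ ha₄ halg1 hw₄alg ha₄0 (by ring) hu₃
  obtain ⟨RT, hRTd, hRTi, hRT⟩ := stub_inversionMove L hL S hS P hP x y hx hy hx0 hx1 hy0 hy1 hxy RP
    hRPd hRPi
  have hinv : signedClass ρ ((1 - x⁻¹) / (1 - y⁻¹)) + signedClass ρ ((1 - x⁻¹) / (1 - y⁻¹))⁻¹ ∈
      KZ.relations := stub_inversionRelation ρ hρ' (signedClass ρ) hB _ h4
  -- the kernel lemma on the five solids
  have hker : sg x • KZ.of R4 + (-sg y) • KZ.of R3 + sg (y / x) • KZ.of R2 +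
      (-sg ((1 - x⁻¹) / (1 - y⁻¹))) • KZ.of RT + sg ((1 - x) / (1 - y)) • KZ.of R1 ∈ KZ.relations := by
    have hind := stub_fiveTermIndicator L hL S hS P hP sg hsg x y hx0 hx1 hy0 hy1 hxy
    have key := stub_valuationKernel 3 5 ![R4, R3, R2, RT, R1]
      ![sg x, -sg y, sg (y / x), -sg ((1 - x⁻¹) / (1 - y⁻¹)), sg ((1 - x) / (1 - y))]
      (fun p => 1 / p 2 ^ 3) (by
        intro i
        fin_cases i
        · exact hR4i
        · exact hR3i
        · exact hR2i
        · exact hRTi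
        · exact hR1i) (by
        filter_upwards [hind] with p hp
        rw [Fin.sum_univ_five]
        simp only [Matrix.cons_val_zero, Matrix.cons_val_one, Matrix.cons_val]
        rw [hR4d, hR3d, hR2d, hRTd, hR1d]
        push_cast
        linear_combination hp)
    rw [Fin.sum_univ_five] at key
    simpa only [Matrix.cons_val_zero, Matrix.cons_val_one, Matrix.cons_val] using key
  -- bookkeeping in the free abelian group
  have hw₄B : signedClass ρ ((starRingEnd ℂ) ((1 - x⁻¹) / (1 - y⁻¹))⁻¹) =
      -signedClass ρ ((1 - x⁻¹) / (1 - y⁻¹))⁻¹ := signedClass_conj ρ _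
  have hsg₄ : sg ((starRingEnd ℂ) ((1 - x⁻¹) / (1 - y⁻¹))⁻¹) = sg ((1 - x⁻¹) / (1 - y⁻¹)) :=
    sg_conj_inv sg hsg _
  rw [hw₄B, hsg₄] at hRP
  have e : fiveTerm (signedClass ρ) x y =
      (signedClass ρ x - sg x • KZ.of R4) - (signedClass ρ y - sg y • KZ.of R3)
      + (signedClass ρ (y / x) - sg (y / x) • KZ.of R2)
      + (signedClass ρ ((1 - x) / (1 - y)) - sg ((1 - x) / (1 - y)) • KZ.of R1)
      - (signedClass ρ ((1 - x⁻¹) / (1 - y⁻¹)) + signedClass ρ ((1 - x⁻¹) / (1 - y⁻¹))⁻¹)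
      - (-signedClass ρ ((1 - x⁻¹) / (1 - y⁻¹))⁻¹ - sg ((1 - x⁻¹) / (1 - y⁻¹)) • KZ.of RP)
      - sg ((1 - x⁻¹) / (1 - y⁻¹)) • (KZ.of RP - KZ.of RT)
      + (sg x • KZ.of R4 + (-sg y) • KZ.of R3 + sg (y / x) • KZ.of R2 +
          (-sg ((1 - x⁻¹) / (1 - y⁻¹))) • KZ.of RT + sg ((1 - x) / (1 - y)) • KZ.of R1) := by
    simp only [fiveTerm, smul_sub, neg_smul]
    abel
  rw [e]
  exact add_mem (sub_mem (sub_mem (sub_mem (add_mem (add_mem (sub_mem hR4 hR3) hR2) hR1) hinv) hRP)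
    (AddSubgroup.zsmul_mem _ hRT _)) hker

/-- **The line closes the crux**: composition of the stubs. Per standard family `ρ` (reduction
`fiveTermTransfer_iff` of `Negative/LoadBearing.lean`): realise the five signed terms, by
`stub_prismClass` (four prisms; the finite term after `stub_inversionRelation`) and
`stub_inversionMove`, as `εᵢ • [Rᵢ]` on the five sub-solids of `{∞,0,1,x,y}` in one copy of `ℍ³`,
then apply `stub_valuationKernel` with the a.e. identity `stub_fiveTermIndicator`. [folklore] -/
theorem FiveTermTransfer_of : FiveTermTransfer := by
  rw [fiveTermTransfer_iff]
  intro ρ hρ x y hx hy hx0 hx1 hy0 hy1 hxy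
  let L : ℂ → ℂ → (Fin 3 → ℝ) → ℝ :=
    fun u v p => (v.re - u.re) * (p 1 - u.im) - (v.im - u.im) * (p 0 - u.re)
  let S : ℂ → ℂ → ℂ → (Fin 3 → ℝ) → ℝ := fun u v w p =>
    (p 0 ^ 2 + p 1 ^ 2 + p 2 ^ 2) * (u.re * (v.im - w.im) - u.im * (v.re - w.re) + (v.re * w.im - v.im * w.re)) - p 0 * (Complex.normSq u * (v.im - w.im) - u.im * (Complex.normSq v - Complex.normSq w) + (Complex.normSq v * w.im - v.im * Complex.normSq w)) + p 1 * (Complex.normSq u * (v.re - w.re) - u.re * (Complex.normSq v - Complex.normSq w) + (Complex.normSq v * w.re - v.re * Complex.normSq w)) - (Complex.normSq u * (v.re * w.im - v.im * w.re) - u.re * (Complex.normSq v * w.im - v.im * Complex.normSq w) + u.im * (Complex.normSq v * w.re - v.re * Complex.normSq w))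
  let P : ℂ → ℂ → ℂ → Set (Fin 3 → ℝ) := fun u v w =>
    {p | 0 < p 2 ∧ 0 < L u v ![w.re, w.im, 0] * L u v p ∧ 0 < L u v ![w.re, w.im, 0] * L v w p ∧ 0 < L u v ![w.re, w.im, 0] * L w u p ∧ 0 < L u v ![w.re, w.im, 0] * S u v w p}
  let sg : ℂ → ℤ := fun w => if 0 < w.im then 1 else if w.im < 0 then -1 else 0
  exact fiveTerm_mem_relations L (fun _ _ _ => rfl) S (fun _ _ _ _ => rfl) P (fun _ _ _ => rfl) sg
    (fun _ => rfl) ρ hρ x y hx hy hx0 hx1 hy0 hy1 hxy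

end Summit.KontsevichZagierPeriods.HyperbolicBloch.FiveTerm
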